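import Summits.QuantumFields.BalabanUV.T4Continuum.Support.NE7ApeCurvedRepDockingStrong
import Summits.QuantumFields.BalabanUV.T4Continuum.Support.NE7TangentTransportSameTopDocked
import HarnessLib

/-!
# NE7ApeCurvedRepDockingPriced — F66 WITH THE TRANSPORT LETTER DISCHARGED AT ITS HONEST PRICE: when `U` and `W` lie over the SAME top datum, E′'s Landau
# representative `U^u = We^{Z}` has top mismatch `ω ≤ 8·c₀·M²·c_R·b₀` (F74 + E′'s `‖u − 1‖ ≤ 4c₀M²c_Rb₀`), so F71 discharges `hTT` with
# `τ = x′·c₁·(M^d∕M²)·(Λ + 2d·ω·C_F)` — (APE) with a datum ⇐ E′ + (L1) + α₁ + (L2) + (L3), the `ω`-term DISPLAYED IN THE RADIUS (file 11)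

Cell `pub-balaban`, rung (B)+1 sub-cell t4, lineage `b2b-balaban-t4-ne7-p1` (CRUX PROVER NE7 #1 = OWNER of row NE7), generation 76; memo
`t4/b2b-balaban-t4-ne7-p1-g76/TT-CURVED-LETTER.md` §2∕§4.  File F77 (over F66's parents — F59 `NE7CurvedLiftBookkeepingApprox`, F65 `NE7ExpansionRemainderCurvedStrong`, row NE3's E′
`Spine/NE3/CurvedLandauRep.exists_landauRep_W`, F39 `NE7TanCriticalGauge`, `NE7ConvOneStepWeightedUnique` — and this gen's F71 `NE7TangentTransportCurvedRightInv`, F72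
`NE7FramePotCurvedL1`, F73 `NE7QbarCurvedBaseBudget`, F74 `NE7TopMismatchLetters.norm_cavgIter_gaugeAct_sub_le`, `NE3EnergyVary.smallField_vary`, `vary_isUnitaryCfg`, `vary_add_period`).
WHY.  F66 displays `hTT` for all Landau representatives; F76 discharges it for a DISPLAYED fibre-preserving representative.  THIS FILE keeps E′ (the representative PRODUCED,
as in F66) and pays the honest price: for a field `U` over the same top datum as `W` (`cavgIter (j+1) U = cavgIter (j+1) W` — the (APE) situation), E′'s gauge `u` has
`‖u − 1‖ ≤ θ_u := 4c₀M²c_Rb₀`, so the representative's top mismatch is `ω ≤ 2θ_u` (F74) and F71 gives `hTT` with `τ = x′c₁(M^d∕M²)(Λ + 2d·(2θ_u)·C_F)`, `Λ` by F73 at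
`r₀′ = e^{α₀} − 1`, `C_F = 2dLK_maj` by F72.  The conclusion is F66's radius with this `τ`: the term `x′c₁(M^d∕M²)·4dθ_u·2dLK_maj ≍ δ′·c₁·M^{d−2}·M²c_Rb₀·const` is the
NUMBER the desk asked for — it is of the closing order `small·δ∕M²` iff `M^{d+2}c_Rb₀ ≲ small`, i.e. never in the regime `M²b₀ ≲ 1∕10` of E′: the kernel form of the located
point (memo §2).  Everything else is as in F66.
WHAT ([folklore]; 0 def, 0 sorry).  **`smallField_of_tanCritical_curvedLetters_W_priced`** — F66's hypotheses MINUS `hTT`, PLUS `cavgIter (j+1) U = cavgIter (j+1) W`, `2 ≤ d`, and route Π's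
W5∕W6 lines ∕ `LevelSmall` at `x′ = x + 4(e^{α₀} − 1)`; conclusion `SmallField U (x + K_G(τ + ρ_W + κ + ν) + c_N + 28α₀²)` with the displayed `τ`.
HONEST FRAMING (page 1): composition; (L1), `α₁`, (L2), (L3) and E′'s initial (−1)∕(−2) gauge are HYPOTHESES; the `ω`-term makes this (APE) NON-CLOSING as priced — it records
the gap, it does not bridge it; nothing of Bałaban's asserted; (APE) on curved data NOT proved; NOT ONE-STEP, NOT NE7; spine 0∕9; finite T⁴ rung (B)+1 — NOT infinite volume,
NOT mass gap, NOT `BetaPertH`, NOT Clay.  Continuum YM on T⁴ ⇐ BetaPertH ∧ nine spine estimates (0/9 proved); BetaPertH ⇐ (D1) ∧ (D4) ∧ CAP+tail; G-an2-4 gates asym, D1 and NE2/3/4.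
-/

set_option autoImplicit false

open scoped BigOperators Matrix Matrix.Norms.L2Operator
open NormedSpace Finset Set

namespace Summit.QuantumFields.BalabanUV.T4Continuum.NE7ApeCurvedRepDockingPriced

open Literature.MathematicalPhysics.QuantumFieldTheory.Balaban1983to89
open B7Prop1Explicit B7Prop2Explicit MatrixLog UnitaryModel
open T4AveragingDeficitWall (Ad IsUnitaryCfg IsSkewDir SmallField vary curlAt dirL1)
open T4AveragingDeficitWallBoundary (IsPeriodicCfg periodBox)
open AveragingDeficitPeriodicCounting (IsPeriodicDir)
open AveragingDeficitTwoLevelPrep (twoLevelSmall)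
open AveragingDeficitMultiLevelPrep (cavgIter LevelSmall)
open AveragingDeficitPlaqDeriv (vary_isUnitaryCfg)
open MinimalActionLevels (perWin)
open BlockAverageVaryHolo (nbRad)
open NE3HessForm (hess dAction)
open NE3TangentCovariantTower (dirIter)
open NE3EnergyShapes (IsUnitarySite IsPeriodicSite)
open NE3CovariantWeitzenbock (covDiv)
open NE3RightInverseSupLetters (frameC)
open NE3.PairLandauB8 (IsLandauB8)
open NE3.CurvedLandauRep (exists_landauRep_W)
open NE3QbarIterCovLiftPrep (cruxC)
open NE3RightInverseSolveLetters (thetaLoc)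
open NE3HatInvCurlLetters (curl1C curl1C_nonneg)
open NE3EnergyVary (smallField_vary)
open NE3QuadRemainderTower (vary_add_period)
open NE7TanCriticalGauge (tanCritical_gaugeAct)
open NE7ConvOneStepWeightedUnique (smallField_of_gaugeAct_eq)
open NE7CurvedLiftBookkeepingApprox (smallField_vary_of_curvedLetters_approxNorth)
open NE7ExpansionRemainderCurvedStrong (abs_dAction_vary_sub_dAction_sub_hess_le_W_strong)
open NE7TangentTransportCurvedRightInv (tangent_transport_curved_rightInvW)
open NE7QbarCurvedBaseBudget (sum_norm_QbarIter_sub_QbarIter_le_budget)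
open NE7FramePotCurvedL1 (sum_norm_framePotW_le_Kmaj)
open NE7TopMismatchLetters (norm_cavgIter_gaugeAct_sub_le)

noncomputable section

variable {d : ℕ} {n : Type*} [Fintype n] [DecidableEq n]

/-- **(APE) WITH A DATUM, THE TRANSPORT LETTER DISCHARGED AT ITS HONEST PRICE** (statement in the module docstring). [folklore] -/
theorem smallField_of_tanCritical_curvedLetters_W_priced [Nonempty n] (hd : 2 ≤ d) {L N : ℕ} [NeZero N] (hL : 2 ≤ L) (j : ℕ)
    -- the background
    {W : Site d → Fin d → (Matrix n n ℂ)ˣ} {x x₁ : ℝ} (hWu : IsUnitaryCfg W) (hWP : IsPeriodicCfg W ((N * L ^ (j + 1) : ℕ) : ℤ))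
    (hx : 0 ≤ x) (hs : LevelSmall d L j x) (hWx : SmallField W x) (hx10 : 0 ≤ x₁)
    (hgrad : ∀ (p : Site d) (μ κ : Fin d), κ ≠ μ →
      ‖Ad (W p μ) ((hol W (p + e μ) (plaqWord κ μ) : (Matrix n n ℂ)ˣ) : Matrix n n ℂ) - ((hol W p (plaqWord κ μ) : (Matrix n n ℂ)ˣ) : Matrix n n ℂ)‖ ≤ x₁)
    (hbx : 23040 * (d : ℝ) ^ 4 * (frameC d L + d) ^ 2 * ((L : ℝ) ^ (j + 1)) ^ 2 * x ≤ 1)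
    (hcx : 11520 * (d : ℝ) ^ 4 * (frameC d L + d) ^ 3 * ((L : ℝ) ^ (j + 1)) ^ 3 * x₁ ≤ 1)
    (hbx' : 256 * (d : ℝ) ^ 2 * ((L : ℝ) ^ (j + 1)) ^ 2 * x ≤ 1) (hcx' : 16 * (d : ℝ) * ((L : ℝ) ^ (j + 1)) ^ 3 * x₁ ≤ 1)
    -- the field: of the class, tangent-critical, (−1)/(−2)-close to `W`
    {U : Site d → Fin d → (Matrix n n ℂ)ˣ} (hUu : IsUnitaryCfg U) (hUP : IsPeriodicCfg U ((N * L ^ (j + 1) : ℕ) : ℤ))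
    {xU : ℝ} (hxU : 0 ≤ xU) (hsU : LevelSmall d L j xU) (hUxU : SmallField U xU)
    (hcritU : ∀ Y : Site d → Fin d → Matrix n n ℂ, IsSkewDir Y → IsPeriodicDir Y ((N * L ^ (j + 1) : ℕ) : ℤ) →
      dirIter L (j + 1) U Y = 0 → dAction U Y (perWin d (N * L ^ (j + 1))) = 0)
    {r₀ b₀ : ℝ} (hr₀ : ∀ (y : Site d) (μ : Fin d), ‖(((W y μ)⁻¹ * U y μ : (Matrix n n ℂ)ˣ) : (Matrix n n ℂ)) - 1‖ ≤ r₀)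
    (hb₀ : ∀ x : Site d, ‖covDiv W (fun y μ => mlog (((W y μ)⁻¹ * U y μ : (Matrix n n ℂ)ˣ) : (Matrix n n ℂ))) x‖ ≤ b₀)
    (hreg₁ : (36 * (d : ℝ) * (frameC d L + d) ^ 2) * ((L : ℝ) ^ (j + 1)) ^ 2
      * ((1 + 2 * (Fintype.card n : ℝ) * (64 * (d : ℝ) ^ 2 * N) ^ d + 27 * (Fintype.card n : ℝ) ^ 3 * (512 : ℝ) ^ d * (N : ℝ) ^ d) * b₀) ≤ 1 / 10)
    (hreg₂ : (36 * (d : ℝ) * (frameC d L + d)) * (L : ℝ) ^ (j + 1)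
      * ((1 + 2 * (Fintype.card n : ℝ) * (64 * (d : ℝ) ^ 2 * N) ^ d + 27 * (Fintype.card n : ℝ) ^ 3 * (512 : ℝ) ^ d * (N : ℝ) ^ d) * b₀) ≤ 1 / 25)
    (hreg₃ : r₀ + 5 / 2 * ((36 * (d : ℝ) * (frameC d L + d)) * (L : ℝ) ^ (j + 1)
      * ((1 + 2 * (Fintype.card n : ℝ) * (64 * (d : ℝ) ^ 2 * N) ^ d + 27 * (Fintype.card n : ℝ) ^ 3 * (512 : ℝ) ^ d * (N : ℝ) ^ d) * b₀)) ≤ 1 / 20)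
    (hline : (1 + 2 * (Fintype.card n : ℝ) * (64 * (d : ℝ) ^ 2 * N) ^ d + 27 * (Fintype.card n : ℝ) ^ 3 * (512 : ℝ) ^ d * (N : ℝ) ^ d)
      * (4 * ((36 * (d : ℝ) * (frameC d L + d) ^ 2) * ((L : ℝ) ^ (j + 1)) ^ 2)
          * (b₀ + 4 * ((1 + 2 * (Fintype.card n : ℝ) * (64 * (d : ℝ) ^ 2 * N) ^ d + 27 * (Fintype.card n : ℝ) ^ 3 * (512 : ℝ) ^ d * (N : ℝ) ^ d) * b₀))
        + 25 * d * (r₀ + 5 / 2 * ((36 * (d : ℝ) * (frameC d L + d)) * (L : ℝ) ^ (j + 1)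
            * ((1 + 2 * (Fintype.card n : ℝ) * (64 * (d : ℝ) ^ 2 * N) ^ d + 27 * (Fintype.card n : ℝ) ^ 3 * (512 : ℝ) ^ d * (N : ℝ) ^ d) * b₀)))
            * ((36 * (d : ℝ) * (frameC d L + d)) * (L : ℝ) ^ (j + 1))
        + 14 * d * ((36 * (d : ℝ) * (frameC d L + d)) * (L : ℝ) ^ (j + 1)) ^ 2
            * ((1 + 2 * (Fintype.card n : ℝ) * (64 * (d : ℝ) ^ 2 * N) ^ d + 27 * (Fintype.card n : ℝ) ^ 3 * (512 : ℝ) ^ d * (N : ℝ) ^ d) * b₀)) ≤ 1 / 2)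
    -- the sup radius of the representative
    {α₀ : ℝ} (hα0 : 0 ≤ α₀) (hα₀ : 2 * (r₀ + 5 / 2 * ((36 * (d : ℝ) * (frameC d L + d)) * (L : ℝ) ^ (j + 1)
        * ((1 + 2 * (Fintype.card n : ℝ) * (64 * (d : ℝ) ^ 2 * N) ^ d + 27 * (Fintype.card n : ℝ) ^ 3 * (512 : ℝ) ^ d * (N : ℝ) ^ d) * b₀))) ≤ α₀)
    -- the four remaining analytic letters at `W`
    (S : Set (Site d → Fin d → Matrix n n ℂ)) {cN KG κ ν : ℝ} (hκ : 0 ≤ κ) (hν : 0 ≤ ν)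
    (hNlift : ∀ Z : Site d → Fin d → Matrix n n ℂ, IsSkewDir Z → IsPeriodicDir Z ((N * L ^ (j + 1) : ℕ) : ℤ) →
      IsLandauB8 (d := d) L N (j + 1) W Z → (∀ y μ, ‖Z y μ‖ ≤ α₀) →
      ∃ AN : Site d → Fin d → Matrix n n ℂ, IsPeriodicDir AN ((N * L ^ (j + 1) : ℕ) : ℤ) ∧
        dirIter L (j + 1) W AN = dirIter L (j + 1) W Z ∧
        (∀ z μ' ν', μ' ≠ ν' → ‖curlAt W AN z μ' ν'‖ ≤ cN) ∧
        (∀ Y : Site d → Fin d → Matrix n n ℂ, IsSkewDir Y → IsPeriodicDir Y ((N * L ^ (j + 1) : ℕ) : ℤ) → dirIter L (j + 1) W Y = 0 →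
          |hess W AN Y (perWin d (N * L ^ (j + 1)))| ≤ ν * dirL1 Y (periodBox (d := d) (N * L ^ (j + 1)))) ∧
        (fun y μ => Z y μ - AN y μ) ∈ S)
    {α₁ : ℝ} (hα1 : 0 ≤ α₁)
    (hGrad : ∀ Z : Site d → Fin d → Matrix n n ℂ, IsSkewDir Z → IsPeriodicDir Z ((N * L ^ (j + 1) : ℕ) : ℤ) →
      IsLandauB8 (d := d) L N (j + 1) W Z → (∀ y μ, ‖Z y μ‖ ≤ α₀) →
      ∀ (y : Site d) (κ τ : Fin d), ‖Ad (W (y + e κ) τ) (Z (y + e τ) κ) - Z y κ‖ ≤ α₁)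
    (hG : ∀ X ∈ S, IsPeriodicDir X ((N * L ^ (j + 1) : ℕ) : ℤ) → dirIter L (j + 1) W X = 0 → ∀ g : ℝ, 0 ≤ g →
      (∀ Y : Site d → Fin d → Matrix n n ℂ, IsSkewDir Y → IsPeriodicDir Y ((N * L ^ (j + 1) : ℕ) : ℤ) → dirIter L (j + 1) W Y = 0 →
        |hess W X Y (perWin d (N * L ^ (j + 1)))| ≤ g * dirL1 Y (periodBox (d := d) (N * L ^ (j + 1)))) →
      ∀ z μ' ν', μ' ≠ ν' → ‖curlAt W X z μ' ν'‖ ≤ KG * g)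
    (hWten : ∀ Y : Site d → Fin d → Matrix n n ℂ, IsSkewDir Y → IsPeriodicDir Y ((N * L ^ (j + 1) : ℕ) : ℤ) → dirIter L (j + 1) W Y = 0 →
      |dAction W Y (perWin d (N * L ^ (j + 1)))| ≤ κ * dirL1 Y (periodBox (d := d) (N * L ^ (j + 1))))
    -- NEW: the field and the background lie over the SAME top datum; the regime at `x′ = x + 4(e^{α₀} − 1)`
    (hTopUW : cavgIter L (j + 1) U = cavgIter L (j + 1) W)
    (hs' : LevelSmall d L j (x + 4 * (Real.exp α₀ - 1)))
    (hθ : cruxC d L * (((L : ℝ) ^ (j + 1)) ^ 2 * (x + 4 * (Real.exp α₀ - 1))) < 1)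
    (hθl : thetaLoc d L * (((L : ℝ) ^ (j + 1)) ^ 2 * (x + 4 * (Real.exp α₀ - 1))) < 1)
    (hε : ((L : ℝ) ^ (j + 1)) ^ 2 * (x + 4 * (Real.exp α₀ - 1)) ≤ 1) :
    SmallField U (x + (KG * (((x + 4 * (Real.exp α₀ - 1))
            * ((curl1C d L / (1 - thetaLoc d L * (((L : ℝ) ^ (j + 1)) ^ 2 * (x + 4 * (Real.exp α₀ - 1)))))
                * (((L : ℝ) ^ (j + 1)) ^ d / ((L : ℝ) ^ (j + 1)) ^ 2))
            * ((Real.exp (((L : ℝ) ^ d / L) * ((d : ℝ) * (16 * ((d : ℝ) + 1) * ((d : ℝ) + 4) * (L : ℝ) ^ 2)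
                  * (1250 * ((nbRad d L : ℝ) + L) + 8 * ((d : ℝ) * L) + 2 * L)) * (2 / twoLevelSmall d L))
                * ((L : ℝ) / (L : ℝ) ^ d) ^ j
                * (((d : ℝ) * (2 * nbRad d L + 1) ^ d) * ((2 * (d : ℝ) + 4) * (L : ℝ) ^ 2) * (2 * (L : ℝ) ^ j) * (Real.exp α₀ - 1)
                  + (17 / 8 * ((L : ℝ) ^ 2) ^ j * (x + 4 * (Real.exp α₀ - 1)))
                    * (((d : ℝ) * (2 * nbRad d L + 1) ^ d) * ((2 * (d : ℝ) + 4)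
                          * (2 * (2 * L * (nbRad d L : ℝ) + 128 * ((d : ℝ) + 1) * ((d : ℝ) + 4) * (L : ℝ) ^ 2)))
                      + ((d : ℝ) * (2 * nbRad d L + 1) ^ d) * ((2 * (d : ℝ) + 4) * (L : ℝ) ^ 2 * (2 * (nbRad d L : ℝ))
                          + 2 * (8 * (L : ℝ) + (1250 * ((nbRad d L : ℝ) + L) + 8 * (d * L) + 2 * L))
                              * (16 * ((d : ℝ) + 1) * ((d : ℝ) + 4) * (L : ℝ) ^ 2)))))
              + 2 * d * (2 * (4 * ((36 * (d : ℝ) * (frameC d L + d) ^ 2) * ((L : ℝ) ^ (j + 1)) ^ 2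
        * ((1 + 2 * (Fintype.card n : ℝ) * (64 * (d : ℝ) ^ 2 * N) ^ d + 27 * (Fintype.card n : ℝ) ^ 3 * (512 : ℝ) ^ d * (N : ℝ) ^ d) * b₀)))) * (2 * ((d : ℝ) * L) * Real.exp (((L : ℝ) ^ d / L) * ((d : ℝ) * (16 * ((d : ℝ) + 1) * ((d : ℝ) + 4) * (L : ℝ) ^ 2)
                  * (1250 * ((nbRad d L : ℝ) + L) + 8 * ((d : ℝ) * L) + 2 * L)) * (2 / twoLevelSmall d L))))) + (Fintype.card (T4AveragingDeficitWall.Plane d) : ℝ)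
          * (2 * (240 * (Real.exp α₀ - 1) * α₀ * (2 * α₁ + 24 * α₀ * (Real.exp α₀ - 1) + x) + 8 * α₀ * (2 * α₁ + 24 * α₀ * (Real.exp α₀ - 1))
              + 6 * (Real.exp α₀ - 1) * (2 * α₁ + 24 * (Real.exp α₀ - 1) * α₀)
              + (2 * α₁ + 24 * (Real.exp α₀ - 1) * α₀) * (2 * α₁ + 24 * α₀ * (Real.exp α₀ - 1))
              + 960 * (Real.exp α₀ - 1) * α₀ ^ 2 + 32 * x * α₀ ^ 2)
            + (64 * α₀ * α₁ + 1024 * x * α₀ ^ 2)) + κ + ν) + cN + 28 * α₀ ^ 2)) := by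
  have hd1 : 1 ≤ d := by omega
  have hL1 : 1 ≤ L := by omega
  have hP : 1 ≤ N * L ^ (j + 1) := Nat.mul_pos (Nat.pos_of_ne_zero (NeZero.ne N)) (Nat.pow_pos (by omega))
  have he0 : 0 ≤ Real.exp α₀ - 1 := by have := Real.add_one_le_exp α₀; linarith
  have hρ0 : 0 ≤ (Fintype.card (T4AveragingDeficitWall.Plane d) : ℝ)
          * (2 * (240 * (Real.exp α₀ - 1) * α₀ * (2 * α₁ + 24 * α₀ * (Real.exp α₀ - 1) + x) + 8 * α₀ * (2 * α₁ + 24 * α₀ * (Real.exp α₀ - 1))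
              + 6 * (Real.exp α₀ - 1) * (2 * α₁ + 24 * (Real.exp α₀ - 1) * α₀)
              + (2 * α₁ + 24 * (Real.exp α₀ - 1) * α₀) * (2 * α₁ + 24 * α₀ * (Real.exp α₀ - 1))
              + 960 * (Real.exp α₀ - 1) * α₀ ^ 2 + 32 * x * α₀ ^ 2)
            + (64 * α₀ * α₁ + 1024 * x * α₀ ^ 2)) := by positivity
  -- brick E′: the Landau representative relative to `W`, WITH the size of its gauge
  obtain ⟨u, Z, huU, huP, hZs, hZP, hrep, hLan, -, hZsup, hu1, -⟩ :=
    exists_landauRep_W hd1 hL j hWu hWP hx hs hWx hx10 hgrad hbx hcx hbx' hcx' hUu hUP hr₀ hb₀ hreg₁ hreg₂ hreg₃ hline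
  have hZα : ∀ y μ, ‖Z y μ‖ ≤ α₀ := fun y μ => (hZsup y μ).trans hα₀
  -- tangent-criticality is gauge covariant
  have hcrit' : ∀ Y' : Site d → Fin d → Matrix n n ℂ, IsSkewDir Y' → IsPeriodicDir Y' ((N * L ^ (j + 1) : ℕ) : ℤ) →
      dirIter L (j + 1) (vary W Z 1) Y' = 0 → dAction (vary W Z 1) Y' (perWin d (N * L ^ (j + 1))) = 0 := by
    rw [← hrep]
    exact tanCritical_gaugeAct hL1 j hUu hxU hsU hUxU huU huP hcritU
  -- the letters at this representative; hEXP by F65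
  obtain ⟨AN, hNP, hNexact, hN7, hNorth, hTS⟩ := hNlift Z hZs hZP hLan hZα
  have hZ1 := hGrad Z hZs hZP hLan hZα
  have hEXP : ∀ Y : Site d → Fin d → Matrix n n ℂ, IsSkewDir Y → IsPeriodicDir Y ((N * L ^ (j + 1) : ℕ) : ℤ) →
      |dAction (vary W Z 1) Y (perWin d (N * L ^ (j + 1))) - dAction W Y (perWin d (N * L ^ (j + 1))) - hess W Z Y (perWin d (N * L ^ (j + 1)))|
        ≤ (Fintype.card (T4AveragingDeficitWall.Plane d) : ℝ)
          * (2 * (240 * (Real.exp α₀ - 1) * α₀ * (2 * α₁ + 24 * α₀ * (Real.exp α₀ - 1) + x) + 8 * α₀ * (2 * α₁ + 24 * α₀ * (Real.exp α₀ - 1))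
              + 6 * (Real.exp α₀ - 1) * (2 * α₁ + 24 * (Real.exp α₀ - 1) * α₀)
              + (2 * α₁ + 24 * (Real.exp α₀ - 1) * α₀) * (2 * α₁ + 24 * α₀ * (Real.exp α₀ - 1))
              + 960 * (Real.exp α₀ - 1) * α₀ ^ 2 + 32 * x * α₀ ^ 2)
            + (64 * α₀ * α₁ + 1024 * x * α₀ ^ 2))
          * dirL1 Y (periodBox (d := d) (N * L ^ (j + 1))) :=
    fun Y _ hYP => abs_dAction_vary_sub_dAction_sub_hess_le_W_strong hP hWu hWP hx hWx hZs hZP hα0 hα1 hZα hZ1 hYP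
  -- NEW: hTT by F71 at the honest top mismatch `ω = 2·θ_u`
  set x' : ℝ := (x + 4 * (Real.exp α₀ - 1)) with hx'
  have hx'0 : 0 ≤ x' := by rw [hx']; positivity
  have hxx' : x ≤ x' := by rw [hx']; linarith
  set Ur : Site d → Fin d → (Matrix n n ℂ)ˣ := vary W Z 1 with hUr
  have hUru : IsUnitaryCfg Ur := vary_isUnitaryCfg hWu hZs 1
  have hUrP : IsPeriodicCfg Ur ((N * L ^ (j + 1) : ℕ) : ℤ) := vary_add_period hWP hZP 1
  have hUrx' : SmallField Ur x' := by rw [hUr, hx']; exact smallField_vary hWu hWx hZs hZα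
  have hWx' : SmallField W x' := fun y κ κ' hne => (hWx y κ κ' hne).trans hxx'
  have hr₀' : ∀ (y : Site d) (μ : Fin d), ‖(((W y μ)⁻¹ * Ur y μ : (Matrix n n ℂ)ˣ) : Matrix n n ℂ) - 1‖ ≤ Real.exp α₀ - 1 := by
    intro y μ
    have e1 : (W y μ)⁻¹ * Ur y μ = expUnit (((1 : ℝ) : ℂ) • Z y μ) := by rw [hUr]; unfold vary; rw [inv_mul_cancel_left]
    rw [e1, val_expUnit]
    refine B7Transfer.norm_exp_sub_one_le_of_le _ ?_
    rw [Complex.ofReal_one, one_smul]; exact hZα y μ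
  have hθu0 : 0 ≤ (4 * ((36 * (d : ℝ) * (frameC d L + d) ^ 2) * ((L : ℝ) ^ (j + 1)) ^ 2
        * ((1 + 2 * (Fintype.card n : ℝ) * (64 * (d : ℝ) ^ 2 * N) ^ d + 27 * (Fintype.card n : ℝ) ^ 3 * (512 : ℝ) ^ d * (N : ℝ) ^ d) * b₀))) := (norm_nonneg _).trans (hu1 0)
  have hTop : ∀ (z : Site d) (κ : Fin d),
      ‖((cavgIter L (j + 1) Ur z κ : (Matrix n n ℂ)ˣ) : Matrix n n ℂ) - ((cavgIter L (j + 1) W z κ : (Matrix n n ℂ)ˣ) : Matrix n n ℂ)‖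
        ≤ 2 * (4 * ((36 * (d : ℝ) * (frameC d L + d) ^ 2) * ((L : ℝ) ^ (j + 1)) ^ 2
        * ((1 + 2 * (Fintype.card n : ℝ) * (64 * (d : ℝ) ^ 2 * N) ^ d + 27 * (Fintype.card n : ℝ) ^ 3 * (512 : ℝ) ^ d * (N : ℝ) ^ d) * b₀))) := by
    intro z κ
    rw [← hrep]
    exact norm_cavgIter_gaugeAct_sub_le hL1 j hUu hxU hsU hUxU hTopUW huU (fun z => hu1 _) z κ
  have hΛ := fun (Y₂ : Site d → Fin d → Matrix n n ℂ) (_ : IsSkewDir Y₂) (hY₂P : IsPeriodicDir Y₂ ((N * L ^ (j + 1) : ℕ) : ℤ))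
      (_ : dirIter L (j + 1) W Y₂ = 0) =>
    sum_norm_QbarIter_sub_QbarIter_le_budget (d := d) hL j hUru hWu hx'0 hs' hUrx' hWx' hUrP hWP he0 hr₀' hY₂P
  have hF := fun (Y₂ : Site d → Fin d → Matrix n n ℂ) (_ : IsSkewDir Y₂) (hY₂P : IsPeriodicDir Y₂ ((N * L ^ (j + 1) : ℕ) : ℤ))
      (_ : dirIter L (j + 1) W Y₂ = 0) =>
    sum_norm_framePotW_le_Kmaj (d := d) hd hL j hWu hx'0 hs' hWx' hY₂P
  have hTT := tangent_transport_curved_rightInvW hL j hUru hWu hUrP hWP hx'0 hs' hUrx' hWx' hθ hθl hε hx'0 hUrx' (by positivity) hTop hF hΛ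
  -- the transport constant is nonnegative
  set e1 : ℝ := Real.exp α₀ - 1 with he1
  set θu : ℝ := (4 * ((36 * (d : ℝ) * (frameC d L + d) ^ 2) * ((L : ℝ) ^ (j + 1)) ^ 2
        * ((1 + 2 * (Fintype.card n : ℝ) * (64 * (d : ℝ) ^ 2 * N) ^ d + 27 * (Fintype.card n : ℝ) ^ 3 * (512 : ℝ) ^ d * (N : ℝ) ^ d) * b₀))) with hθu
  have hden : 0 < 1 - thetaLoc d L * (((L : ℝ) ^ (j + 1)) ^ 2 * x') := by linarith
  have hc1 := curl1C_nonneg d L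
  have htw : 0 < twoLevelSmall d L := by unfold twoLevelSmall; positivity
  have hτ : 0 ≤ (x'
            * ((curl1C d L / (1 - thetaLoc d L * (((L : ℝ) ^ (j + 1)) ^ 2 * x')))
                * (((L : ℝ) ^ (j + 1)) ^ d / ((L : ℝ) ^ (j + 1)) ^ 2))
            * ((Real.exp (((L : ℝ) ^ d / L) * ((d : ℝ) * (16 * ((d : ℝ) + 1) * ((d : ℝ) + 4) * (L : ℝ) ^ 2)
                  * (1250 * ((nbRad d L : ℝ) + L) + 8 * ((d : ℝ) * L) + 2 * L)) * (2 / twoLevelSmall d L))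
                * ((L : ℝ) / (L : ℝ) ^ d) ^ j
                * (((d : ℝ) * (2 * nbRad d L + 1) ^ d) * ((2 * (d : ℝ) + 4) * (L : ℝ) ^ 2) * (2 * (L : ℝ) ^ j) * e1
                  + (17 / 8 * ((L : ℝ) ^ 2) ^ j * x')
                    * (((d : ℝ) * (2 * nbRad d L + 1) ^ d) * ((2 * (d : ℝ) + 4)
                          * (2 * (2 * L * (nbRad d L : ℝ) + 128 * ((d : ℝ) + 1) * ((d : ℝ) + 4) * (L : ℝ) ^ 2)))
                      + ((d : ℝ) * (2 * nbRad d L + 1) ^ d) * ((2 * (d : ℝ) + 4) * (L : ℝ) ^ 2 * (2 * (nbRad d L : ℝ))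
                          + 2 * (8 * (L : ℝ) + (1250 * ((nbRad d L : ℝ) + L) + 8 * (d * L) + 2 * L))
                              * (16 * ((d : ℝ) + 1) * ((d : ℝ) + 4) * (L : ℝ) ^ 2)))))
              + 2 * d * (2 * θu) * (2 * ((d : ℝ) * L) * Real.exp (((L : ℝ) ^ d / L) * ((d : ℝ) * (16 * ((d : ℝ) + 1) * ((d : ℝ) + 4) * (L : ℝ) ^ 2)
                  * (1250 * ((nbRad d L : ℝ) + L) + 8 * ((d : ℝ) * L) + 2 * L)) * (2 / twoLevelSmall d L))))) := by
    have h1 : 0 ≤ curl1C d L / (1 - thetaLoc d L * (((L : ℝ) ^ (j + 1)) ^ 2 * x')) := div_nonneg hc1 hden.le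
    positivity
  -- F59 on the representative
  have hSF := smallField_vary_of_curvedLetters_approxNorth hL1 j hWu hx hs hWx hZs hZP hZα hNP hNexact hN7 hν hNorth S hTS hG hρ0 hEXP hκ hWten
    hcrit' hτ hTT
  -- the radius is gauge invariant
  exact smallField_of_gaugeAct_eq huU hrep hSF

end

end Summit.QuantumFields.BalabanUV.T4Continuum.NE7ApeCurvedRepDockingPriced
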